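import Mathlib.FieldTheory.IntermediateField.Adjoin.Basic
import Mathlib.RingTheory.Norm.Basic
import Mathlib.RingTheory.Localization.Integral
import Mathlib.LinearAlgebra.Matrix.ToLin
import Literature.NumberTheory.Transcendental.ChudnovskyHeights
import HarnessLib

/-!
# Chudnovsky's theorem on periods — existence of the algebraic envelope

Topic `Literature/NumberTheory/Transcendental` (trunk T-TRANSCEND). Node [EN] of the proof of
`Literature.NumberTheory.Transcendental.Chudnovsky1984_thm_7_3_1` (Chudnovsky 1984, Ch. 7, Theorem 3.1), companion of
`ChudnovskyHeights.lean` (where `Envelope` is defined).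

In Gelfond's method for algebraic independence (Chudnovsky 1984, Ch. 7, §2, variant (C),
pp. 307–308: "if `η/ω` is algebraic over `ℚ(π/ω)` …") the hypothesis "all the numbers in play are
algebraic over `ℚ(θ)`" is used through the regular representation of the finite extension
`K = ℚ(θ)(x₀, …, x₃) / ℚ(θ)`: on a basis `β₁, …, β_d`, multiplication by `x_l` is a matrix
`M_l ∈ M_d(ℚ(θ))`; writing the entries as quotients of integer polynomials in `θ` and taking a
common denominator `b ∈ ℤ[T]` gives `N_l ∈ M_d(ℤ[T])` with `N_l(θ) = b(θ) M_l`. We verify the two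
properties recorded in `Envelope θ x`:

* `eigen`: `∑_i β_i N_l(θ)_{ij} = b(θ) x_l β_j` (the basis is a common row eigenvector);
* `det_ne`: for `P ∈ ℤ[T][a₀, …, a₃]` with monomials of degree `≤ n` and `P(θ; x) ≠ 0`,
  `det (homEval N b n P)(θ) = b(θ)^{nd} N_{K/ℚ(θ)}(P(θ; x)) ≠ 0`.

## Contents (no definitions)

* `exists_int_poly_of_mem_adjoin` — elements of `ℚ(θ)` are quotients `R(θ)/S(θ)`, `R, S ∈ ℤ[T]`.
* `exists_envelope` — `(∀ l, IsAlgebraic ℚ(θ) (x l)) → Nonempty (Envelope θ x)`.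
-/

noncomputable section

open scoped Polynomial IntermediateField
open MvPolynomial

namespace Literature.NumberTheory.Transcendental.Chudnovsky

/-- Every element of `ℚ(θ) ⊂ ℂ` is a quotient `R(θ)/S(θ)` of values of *integer* polynomials with
`S(θ) ≠ 0` (clear the denominators of the rational coefficients). [folklore] -/
theorem exists_int_poly_of_mem_adjoin (θ : ℂ) {e : ℂ} (he : e ∈ ℚ⟮θ⟯) :
    ∃ R S : ℤ[X], Polynomial.aeval θ S ≠ 0 ∧
      e * Polynomial.aeval θ S = Polynomial.aeval θ R := by
  rw [IntermediateField.mem_adjoin_simple_iff] at he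
  obtain ⟨r, s, hrs⟩ := he
  by_cases hs : Polynomial.aeval θ s = 0
  · exact ⟨0, 1, by simp, by simp [hrs, hs]⟩
  · obtain ⟨kr, hkr, hR⟩ := IsLocalization.integerNormalization_spec (nonZeroDivisors ℤ) r
    obtain ⟨ks, hks, hS⟩ := IsLocalization.integerNormalization_spec (nonZeroDivisors ℤ) s
    set R := IsLocalization.integerNormalization (nonZeroDivisors ℤ) r
    set S := IsLocalization.integerNormalization (nonZeroDivisors ℤ) s
    have hkr0 : (kr : ℂ) ≠ 0 := by exact_mod_cast nonZeroDivisors.ne_zero hkr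
    have hks0 : (ks : ℂ) ≠ 0 := by exact_mod_cast nonZeroDivisors.ne_zero hks
    have hmap : ∀ (k : ℤ) (q : ℚ[X]) (Q : ℤ[X]), Q.map (algebraMap ℤ ℚ) = k • q →
        Polynomial.aeval θ Q = k * Polynomial.aeval θ q := by
      intro k q Q h
      have := congrArg (Polynomial.aeval θ) h
      rwa [Polynomial.aeval_map_algebraMap, map_zsmul, zsmul_eq_mul] at this
    have hRθ := hmap kr r R hR
    have hSθ := hmap ks s S hS
    refine ⟨Polynomial.C ks * R, Polynomial.C kr * S, ?_, ?_⟩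
    · rw [map_mul, Polynomial.aeval_C, hSθ]
      simp only [algebraMap_int_eq, eq_intCast]
      exact mul_ne_zero hkr0 (mul_ne_zero hks0 hs)
    · rw [map_mul, map_mul, Polynomial.aeval_C, Polynomial.aeval_C, hSθ, hRθ, hrs]
      simp only [algebraMap_int_eq, eq_intCast]
      field_simp

/-- Pulling scalars out of an ordered monomial of matrices: `monoEval (c • M) α = c^{|α|} monoEval M α`.
[folklore] -/
lemma monoEval_smul {d : ℕ} (c : ℂ) (M : Fin 4 → Matrix (Fin d) (Fin d) ℂ) (α : Fin 4 →₀ ℕ) :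
    monoEval (fun l => c • M l) α = c ^ α.degree • monoEval M α := by
  simp only [monoEval, smul_pow, smul_mul_assoc, mul_smul_comm, smul_smul]
  congr 1
  rw [Finsupp.degree_eq_sum, Fin.sum_univ_four]
  ring

/-- A ring map evaluates ordered monomials: `φ(X^α) = monoEval (φ ∘ X) α`. [folklore] -/
lemma map_monomial_eq_monoEval {A : Type*} [CommRing A] {d : ℕ}
    (φ : MvPolynomial (Fin 4) A →+* Matrix (Fin d) (Fin d) ℂ) (α : Fin 4 →₀ ℕ) :
    φ (monomial α 1) = monoEval (fun l => φ (X l)) α := by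
  have : (monomial α (1 : A) : MvPolynomial (Fin 4) A) =
      X 0 ^ α 0 * X 1 ^ α 1 * X 2 ^ α 2 * X 3 ^ α 3 := by
    rw [monomial_eq, C_1, one_mul, Finsupp.prod_fintype _ _ (by simp), Fin.prod_univ_four]
  rw [this]
  simp only [map_mul, map_pow, monoEval]

/-- **Existence of the algebraic envelope.** If `x₀, …, x₃` are algebraic over `ℚ(θ)`, the regular
representation of `ℚ(θ)(x₀, …, x₃)` over `ℚ(θ)`, with denominators cleared, is an `Envelope θ x`
(Chudnovsky 1984, Ch. 7, §2, variant (C), pp. 307–308, where this is used with `θ = π/ω`).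
[cite: Chudnovsky1984, Ch. 7 §2 p. 307] -/
theorem exists_envelope (θ : ℂ) (x : Fin 4 → ℂ) (hx : ∀ l, IsAlgebraic ℚ⟮θ⟯ (x l)) :
    Nonempty (Envelope θ x) := by
  classical
  -- the fields `K₀ = ℚ(θ) ⊆ K = K₀(x) ⊆ ℂ`
  set K₀ : IntermediateField ℚ ℂ := ℚ⟮θ⟯ with hK₀
  let K : IntermediateField K₀ ℂ := IntermediateField.adjoin K₀ (Set.range x)
  haveI hfin : FiniteDimensional K₀ K :=
    IntermediateField.finiteDimensional_adjoin fun y hy => by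
      obtain ⟨l, rfl⟩ := hy
      exact (hx l).isIntegral
  set d : ℕ := Module.finrank K₀ K with hd_def
  let bK : Module.Basis (Fin d) K₀ K := Module.finBasis K₀ K
  have hd : 0 < d := Module.finrank_pos
  let θ₀ : K₀ := ⟨θ, IntermediateField.mem_adjoin_simple_self ℚ θ⟩
  let xK : Fin 4 → K := fun l => ⟨x l, IntermediateField.subset_adjoin K₀ _ ⟨l, rfl⟩⟩
  let M : Fin 4 → Matrix (Fin d) (Fin d) K₀ := fun l => Algebra.leftMulMatrix bK (xK l)
  -- clearing denominators
  have hq : ∀ t : Fin 4 × Fin d × Fin d, ∃ RS : ℤ[X] × ℤ[X], Polynomial.aeval θ RS.2 ≠ 0 ∧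
      ((M t.1 t.2.1 t.2.2 : K₀) : ℂ) * Polynomial.aeval θ RS.2 = Polynomial.aeval θ RS.1 := by
    intro t
    obtain ⟨R, S, h1, h2⟩ := exists_int_poly_of_mem_adjoin θ (M t.1 t.2.1 t.2.2).2
    exact ⟨(R, S), h1, h2⟩
  choose RS hS hRS using hq
  let b : ℤ[X] := ∏ t, (RS t).2
  let N : Fin 4 → Matrix (Fin d) (Fin d) ℤ[X] := fun l =>
    Matrix.of fun i j => (RS (l, i, j)).1 * ∏ t ∈ Finset.univ.erase (l, i, j), (RS t).2
  have hbθ : Polynomial.aeval θ b ≠ 0 := by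
    simp only [b, map_prod]
    exact Finset.prod_ne_zero_iff.mpr fun t _ => hS t
  -- `N_l(θ) = b(θ) M_l`
  have hNθ : ∀ l i j, Polynomial.aeval θ (N l i j) = Polynomial.aeval θ b * ((M l i j : K₀) : ℂ) := by
    intro l i j
    simp only [N, b, Matrix.of_apply, map_mul, map_prod]
    rw [← hRS (l, i, j), ← Finset.mul_prod_erase Finset.univ _ (Finset.mem_univ (l, i, j))]
    ring
  let φ : ℤ[X] →+* ℂ := (Polynomial.aeval θ : ℤ[X] →ₐ[ℤ] ℂ).toRingHom
  -- the basis as complex numbers, and the eigenvector relation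
  let β : Fin d → ℂ := fun i => ((bK i : K) : ℂ)
  have hβ : β ≠ 0 := by
    intro h
    have h0 := congr_fun h ⟨0, hd⟩
    simp only [β, Pi.zero_apply, ZeroMemClass.coe_eq_zero] at h0
    exact bK.ne_zero _ h0
  have heigenK : ∀ l j, (xK l : K) * bK j = ∑ i, M l i j • bK i := by
    intro l j
    conv_lhs => rw [← bK.sum_repr (xK l * bK j)]
    simp only [M, Algebra.leftMulMatrix_eq_repr_mul]
  have heigen : ∀ l, Matrix.vecMul β ((N l).map φ) = (Polynomial.aeval θ b * x l) • β := by
    intro l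
    ext j
    have h := congrArg (fun z : K => (z : ℂ)) (heigenK l j)
    simp only [MulMemClass.coe_mul, IntermediateField.coe_sum, IntermediateField.coe_smul,
      IntermediateField.smul_def, smul_eq_mul] at h
    -- `h : x l * β j = ∑ i, (M l i j : ℂ) * β i`
    simp only [Matrix.vecMul, dotProduct, Matrix.map_apply, Pi.smul_apply, smul_eq_mul]
    change ∑ i, β i * φ (N l i j) = _
    simp only [φ, AlgHom.toRingHom_eq_coe, RingHom.coe_coe, hNθ]
    have : x l * β j = ∑ i, ((M l i j : K₀) : ℂ) * β i := h
    calc ∑ i, β i * (Polynomial.aeval θ b * ((M l i j : K₀) : ℂ))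
        = Polynomial.aeval θ b * ∑ i, ((M l i j : K₀) : ℂ) * β i := by
          rw [Finset.mul_sum]; exact Finset.sum_congr rfl fun i _ => by ring
      _ = Polynomial.aeval θ b * x l * β j := by rw [← this]; ring
  -- the evaluation `ℤ[T][a] → K` and the representation `ρ`
  have hθ₀ : algebraMap K₀ ℂ θ₀ = θ := rfl
  have haevalC : ∀ p : ℤ[X], algebraMap K₀ ℂ (Polynomial.aeval θ₀ p) = Polynomial.aeval θ p := by
    intro p
    rw [← Polynomial.aeval_algebraMap_apply ℂ θ₀ p, hθ₀]
  let evK : MvPolynomial (Fin 4) ℤ[X] →+* K :=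
    MvPolynomial.eval₂Hom (Polynomial.aeval (algebraMap K₀ K θ₀) : ℤ[X] →ₐ[ℤ] K).toRingHom xK
  have hevKC : ∀ p : ℤ[X], evK (C p) = algebraMap K₀ K (Polynomial.aeval θ₀ p) := by
    intro p
    simp only [evK, MvPolynomial.coe_eval₂Hom, MvPolynomial.eval₂_C, AlgHom.toRingHom_eq_coe,
      RingHom.coe_coe]
    rw [Polynomial.aeval_algebraMap_apply]
  have hevK : ∀ P, ((evK P : K) : ℂ) = evC θ x P := by
    intro P
    change ((algebraMap K ℂ).comp evK) P = evC θ x P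
    congr 1
    refine MvPolynomial.ringHom_ext (fun p => ?_) (fun l => ?_)
    · rw [RingHom.coe_comp, Function.comp_apply, evC_C, hevKC, IntermediateField.algebraMap_apply,
        IntermediateField.coe_algebraMap_apply, haevalC]
    · simp [evK, evC, xK]
  let ι : Matrix (Fin d) (Fin d) K₀ →+* Matrix (Fin d) (Fin d) ℂ := (algebraMap K₀ ℂ).mapMatrix
  let ρ : MvPolynomial (Fin 4) ℤ[X] →+* Matrix (Fin d) (Fin d) ℂ :=
    ι.comp ((Algebra.leftMulMatrix bK).toRingHom.comp evK)
  have hρX : ∀ l, ρ (X l) = ι (M l) := by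
    intro l
    simp [ρ, evK, M]
  have hρC : ∀ p : ℤ[X], ρ (C p) = Polynomial.aeval θ p • (1 : Matrix (Fin d) (Fin d) ℂ) := by
    intro p
    simp only [ρ, RingHom.coe_comp, Function.comp_apply, hevKC, AlgHom.toRingHom_eq_coe,
      RingHom.coe_coe, AlgHom.commutes, Matrix.algebraMap_eq_diagonal, ι, RingHom.mapMatrix_apply,
      Pi.algebraMap_def, Algebra.algebraMap_self_apply]
    rw [Matrix.diagonal_map (map_zero _), Matrix.smul_one_eq_diagonal]
    simp only [haevalC]
  have hNmap : ∀ l, (N l).map φ = Polynomial.aeval θ b • ι (M l) := by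
    intro l
    ext i j
    simp only [Matrix.map_apply, Matrix.smul_apply, smul_eq_mul, ι, RingHom.mapMatrix_apply]
    exact hNθ l i j
  -- `(homEval N b n P)(θ) = b(θ)^n ρ(P)` when `deg P ≤ n`
  have hhom : ∀ (n : ℕ) (P : MvPolynomial (Fin 4) ℤ[X]), (∀ α ∈ P.support, α.degree ≤ n) →
      (homEval N b n P).map φ = Polynomial.aeval θ b ^ n • ρ P := by
    intro n P hP
    rw [homEval_map, homEval_eq_sum_of_subset _ _ n (support_map_subset φ P)]
    conv_rhs => rw [P.as_sum, map_sum, Finset.smul_sum]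
    refine Finset.sum_congr rfl fun α hα => ?_
    rw [MvPolynomial.coeff_map]
    have hmono : monoEval (fun l => (N l).map φ) α =
        Polynomial.aeval θ b ^ α.degree • monoEval (fun l => ι (M l)) α := by
      simp_rw [hNmap]
      exact monoEval_smul _ _ α
    have hρmono : ρ (monomial α (P.coeff α)) = φ (P.coeff α) • monoEval (fun l => ι (M l)) α := by
      have hmon : monomial α (P.coeff α) = C (P.coeff α) * monomial α 1 := by
        rw [C_mul_monomial, mul_one]
      rw [hmon, map_mul, hρC, map_monomial_eq_monoEval, smul_one_mul]
      simp_rw [hρX]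
      rfl
    have hφb : φ b = Polynomial.aeval θ b := rfl
    rw [hmono, hρmono, smul_smul, smul_smul, hφb, mul_assoc, ← pow_add,
      Nat.sub_add_cancel (hP α hα), mul_comm]
  refine ⟨Envelope.mk d hd N b hbθ β hβ heigen ?_⟩
  intro n P hP hev
  have hPK : evK P ≠ 0 := by
    intro h0
    apply hev
    rw [← hevK, h0]
    rfl
  haveI : Module.Free K₀ K := Module.Free.of_divisionRing K₀ K
  haveI : Module.Finite K₀ K := hfin
  have hnorm : Algebra.norm K₀ (evK P) ≠ 0 := Algebra.norm_ne_zero_iff.mpr hPK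
  have hdetρ : (ρ P).det = algebraMap K₀ ℂ (Algebra.norm K₀ (evK P)) := by
    rw [Algebra.norm_eq_matrix_det bK, RingHom.map_det]
    rfl
  change φ (homEval N b n P).det ≠ 0
  rw [RingHom.map_det]
  change ((homEval N b n P).map φ).det ≠ 0
  rw [hhom n P hP, Matrix.det_smul, hdetρ, Fintype.card_fin]
  exact mul_ne_zero (pow_ne_zero _ (pow_ne_zero _ hbθ)) ((map_ne_zero _).mpr hnorm)

end Literature.NumberTheory.Transcendental.Chudnovsky

end
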